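import Summits.BirchSwinnertonDyer.BirchSwinnertonDyer.Theorems.PrintCf2RubinValueTwoEllipticUnitsGlobalUnits
import HarnessLib

/-!
# The MOMENTS of the one-`𝔓` measure FAMILY `β ↦ i_𝔓(β)` of the elliptic-unit lane (de Shalit II.4.7 (16)–(17), first half):
# `∫_G κ(g)^{k+1} d i_𝔓(β)(g) = Σ_{c ∈ G/U_0} κ(r_c)^{k+1} · [S⁰] D^k H_{r_c⁻¹ • β}` for EVERY relative unit `β ∈ 𝒰_𝔓`

Cell `bsd-print-cf2`, width seat `bsd-line-cf2-p1-w8` g11 (piece (H3) of the measure side: the local integrals appearing in the two-variable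
integral formula `…EllipticUnitsTwoVariable.integral_twoVariable_eq_sum`); `--supports` the banked S3a item stmt-BirchSwinnertonDyer-24721 (helper,
Theses-free).  THEOREMS ONLY; no named facts (the elliptic units do not enter: `β` is an arbitrary relative norm-coherent unit).

PRINT (de Shalit II.4.7 (16)–(17), p. 60, with I.3.4 (10)–(11), p. 18): "`∫_𝒢 χφ^k dμ⁰_β = Σ_𝔠 χφ^k(𝔠⁻¹) · ∫_G φ^k dμ⁰_{σ_𝔠(β)}`" and, for `χ = 1`,
"`∫_G κ^k dμ_β = Ω_p^{-k} δ_k(β) = D^k log g̃_β(0)`" — the moments of the measure `μ_β = i(β)` attached to ONE norm-coherent unit `β` are the invariant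
derivatives at the origin of its (log-free) Coleman series.  The sibling `…EllipticUnitsLocalMoments` (cf2c-w4 g10) proved the corresponding formula for
the DIVIDED measure `μ` (`δ_{g_𝔠,N𝔠} μ = i(e(𝔠))`); the two-variable integral formula reads the glued measure at a modulus through the integrals of the
FAMILY MEMBERS `i_𝔓((r_c⁻¹ • e_{𝔣_m}(𝔠))_𝔓)` themselves.  THIS file instantiates the tree's β-agnostic
`integral_induce_character_pow_succ_seriesFamily` (`PAdicOneVariableSeriesFamilyMomentsOfCharacter`, II.4.7 (16)–(17) along an abstract tower) at the
named family `localMeasureFamily` (`…EllipticUnitsGlobalUnits`, VERBATIM `induce` of the comapped Amice inverse of the `Θ`-read relative log-free series):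

* ★★ `integral_character_pow_succ_localMeasureFamily` — **for every `β ∈ 𝒰_𝔓` and every `k`:
  `∫_G κ(g)^{k+1} d i_𝔓(β)(g) = Σ_{c ∈ G/U_0} κ(r_c)^{k+1} · [S⁰] D^k H_{r_c⁻¹ • β}`**, `G = Gal(K̄/K(𝔪))` along `K(𝔪v^{n+1})`, `κ = κ_v⁻¹` read in
  `ℤ₂`, `H_β = Θ(j((δ_E g_β)~) ∘ ϑ)`; the socket (11) discharged by `seriesFamily_hsock_of_relNormCoherentUnits` under the continuity / root-of-unity
  hypotheses on `θ`.

HONEST FRAMING: an instantiation of accepted kernel theorems; nothing here closes a crux; no summit statement is proved; BSD is not proved by any of this.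

## References
* [deShalit1987] E. de Shalit, *Iwasawa theory of elliptic curves with complex multiplication* (1987), II.4.7 (16)–(17) (p. 60), I.3.4 (10),
  I.3.5 (11) (p. 18), II.4.6 (14) (p. 59).
-/

-- the summit namespace `Summit.BirchSwinnertonDyer.BirchSwinnertonDyer` repeats the problem name by design (D-0017)
set_option linter.dupNamespace false
set_option autoImplicit false

noncomputable section

open scoped Classical nonZeroDivisors
open scoped NumberField
open Field IsDedekindDomain IsDedekindDomain.HeightOneSpectrum ValuativeRel IsLocalRing MvPowerSeries
open Literature.NumberTheory.NumberFields
open Literature.NumberTheory.GaloisRepresentations Literature.NumberTheory.GaloisRepresentations.IsNonarchimedeanLocalField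
  Literature.NumberTheory.GaloisRepresentations.LubinTate Literature.NumberTheory.GaloisRepresentations.ArtinLocalGlobal
  Literature.NumberTheory.PAdicHodge
open Literature.NumberTheory.EllipticCurves Literature.NumberTheory.EllipticCurves.GroupDistribution
open Literature.NumberTheory.ComplexMultiplication.EllipticUnits
open Summit.BirchSwinnertonDyer.BirchSwinnertonDyer.Theorems.PrintCf2.EllipticUnitsLocal

namespace Summit.BirchSwinnertonDyer.BirchSwinnertonDyer.Theorems.PrintCf2.EllipticUnitsGlobal

variable {K : Type} [Field K] [NumberField K] {𝔪 : Ideal (𝓞 K)} {v : HeightOneSpectrum (𝓞 K)}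

section Local

attribute [local instance] ltNormUniformSpace ltNormIsUniformAddGroup rk1 nF nE fintypeResidueField
attribute [local instance] RelNormCoherentUnits.instCommMonoid

variable [NumberField.IsTotallyComplex K]
  (h𝔪0 : 𝔪 ≠ ⊥) (hv : ¬ 𝔪 ≤ v.asIdeal) (hw : ∀ u : (𝓞 K)ˣ, (u : 𝓞 K) - 1 ∈ 𝔪 → u = 1)
  -- the absolute Lubin–Tate model `π = u·2` at `v` and its unramified base `E`
  (hq : residueFieldCard (v.adicCompletion K) = 2)
  (h2 : (valuation (v.adicCompletion K)).IsUniformizer ((((2 : ℕ) : 𝒪[v.adicCompletion K]) : v.adicCompletion K)))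
  (u : 𝒪[v.adicCompletion K]ˣ)
  (E : IntermediateField (v.adicCompletion K) (AlgebraicClosure (v.adicCompletion K)))
  [FiniteDimensional (v.adicCompletion K) E] [IsGalois (v.adicCompletion K) E] (hE : E ≤ maxUnramified (v.adicCompletion K))
  -- the local analytic data: arithmetic Frobenius, the unit `ε`, the reading `θ : ℂ_{K_v} → ℂ₂`, `j : 𝒪_E → 𝐃`, `e₂ : 𝒪_v ≃ ℤ₂`
  {σ₀ : absoluteGaloisGroup (v.adicCompletion K)} (hσ₀ : IsAbsArithFrob σ₀)
  {ε : (maxUnramifiedCompletion (v.adicCompletion K))ˣ}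
  (hε : maxUnramifiedCompletion.galAut (v.adicCompletion K) σ₀ (ε : maxUnramifiedCompletion (v.adicCompletion K)) =
    algebraMap 𝒪[v.adicCompletion K] (maxUnramifiedCompletion (v.adicCompletion K)) (u : 𝒪[v.adicCompletion K]) *
      (ε : maxUnramifiedCompletion (v.adicCompletion K)))
  (θ : CompletedAlgClosure (v.adicCompletion K) →+* ℂ_[2]) (hθc : Continuous θ)
  (hθ1 : ∀ z : CBall (v.adicCompletion K), ‖θ (z : CompletedAlgClosure (v.adicCompletion K))‖ ≤ 1)
  (hθζ : ∀ ζ' : ℂ_[2], (∃ n : ℕ, ζ' ^ 2 ^ n = 1) →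
    ∃ ζ : CompletedAlgClosure (v.adicCompletion K), (∃ n : ℕ, ζ ^ 2 ^ n = 1) ∧ θ ζ = ζ')
  (j : unitBall E →+* UnrCoeff (v.adicCompletion K))
  (hjC : (algebraMap (UnrCoeff (v.adicCompletion K)) (CBall (v.adicCompletion K))).comp j = unitBallToCBall E)
  (e₂ : v.adicCompletionIntegers K ≃+* ℤ_[2])
  -- the cell maps of the tower `K(𝔪v^{n+1})` for `κ := κ_v⁻¹` read in `ℤ₂`
  (ψ : (n : ℕ) → ↥(absRestrictNormalHom (rayClassField K 𝔪)).ker ⧸ (rayAdicTower (𝔪 := 𝔪) h𝔪0 v).U n → ZMod (2 ^ (n + 1)))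
  (hψ : ∀ (n : ℕ) (g : ↥(absRestrictNormalHom (rayClassField K 𝔪)).ker), g ∈ (rayAdicTower (𝔪 := 𝔪) h𝔪0 v).U 0 →
    ψ n ((rayAdicTower (𝔪 := 𝔪) h𝔪0 v).proj n g) =
      PadicInt.toZModPow (n + 1) ((((Units.map (e₂ : v.adicCompletionIntegers K →+* ℤ_[2]).toMonoidHom).comp
        (rayAdicCharacter h𝔪0 hv hw))⁻¹ g : ℤ_[2]ˣ) : ℤ_[2]))
  [hN : ∀ n, ((rayAdicTower (𝔪 := 𝔪) h𝔪0 v).U n).Normal]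

set_option maxHeartbeats 800000 in
include hθc hθζ in
/-- ★★ **THE MOMENTS OF THE ONE-`𝔓` FAMILY** (de Shalit II.4.7 (16)–(17) with I.3.4 (10)–(11)): for EVERY relative norm-coherent unit `β ∈ 𝒰_𝔓`
and every `k`, **`∫_G κ(g)^{k+1} d i_𝔓(β)(g) = Σ_{c ∈ G/U_0} κ(r_c)^{k+1} · [S⁰] D^k H_{r_c⁻¹ • β}`** — `i_𝔓 = localMeasureFamily` (the `induce` of the
comapped Amice inverse of the `Θ`-read relative log-free series), `G = Gal(K̄/K(𝔪))` along `K(𝔪v^{n+1})`, `κ = κ_v⁻¹` read in `ℤ₂`, `r_c` the tower's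
coset representatives of `U_0`, `H_β = Θ(j((δ_E g_β)~) ∘ ϑ)`; the socket (11) (`∫_{ℤ₂ˣ} x^{k+1} d(x⁻¹D_{H_β}) = [S⁰]D^k H_β`) holds for the relative
units by the trace-zero property of the relative log-free series (`seriesFamily_hsock_of_relNormCoherentUnits`, under the continuity / `2`-power-root-
of-unity hypotheses on `θ`).  VERBATIM `integral_induce_character_pow_succ_seriesFamily` at the named family.
[cite: deShalit1987, II.4.7 (16)–(17) (p. 60), I.3.4 (10), I.3.5 (11) (p. 18), II.4.6 (14) (p. 59)] -/
theorem integral_character_pow_succ_localMeasureFamily (β : RelNormCoherentUnits (isUniformizer_unit_mul h2 u) E) (k : ℕ) :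
    letI := rayAction h𝔪0 hv hw (isUniformizer_unit_mul h2 u) E hE
    (localMeasureFamily h𝔪0 hv hw hq h2 u E hE hσ₀ hε θ hθ1 j hjC e₂ ψ hψ β).integral
        (fun σ ↦ padicIntCast ℂ_[2] (((((Units.map (e₂ : v.adicCompletionIntegers K →+* ℤ_[2]).toMonoidHom).comp
          (rayAdicCharacter h𝔪0 hv hw))⁻¹) σ : ℤ_[2]) ^ (k + 1))) =
      ∑ c' ∈ (rayAdicTower (𝔪 := 𝔪) h𝔪0 v).cells 0,
        padicIntCast ℂ_[2] (((((Units.map (e₂ : v.adicCompletionIntegers K →+* ℤ_[2]).toMonoidHom).comp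
          (rayAdicCharacter h𝔪0 hv hw))⁻¹) ((rayAdicTower (𝔪 := 𝔪) h𝔪0 v).repr 0 c') : ℤ_[2]) ^ (k + 1)) *
        PowerSeries.constantCoeff (mahlerD^[k] ((PowerSeries.subst (compSeriesC h2 hσ₀ u hε)
          ((relTildeSeries (isUniformizer_unit_mul h2 u) E hq hE hσ₀ (LTCoeff.of (v.adicCompletion K) (u : 𝒪[v.adicCompletion K]))
            (((rayAdicTower (𝔪 := 𝔪) h𝔪0 v).repr 0 c')⁻¹ • β)).map j)).map
          (θ.comp ((CBall (v.adicCompletion K)).subtype.comp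
            (algebraMap (UnrCoeff (v.adicCompletion K)) (CBall (v.adicCompletion K))))))) := by
  letI := rayAction h𝔪0 hv hw (isUniformizer_unit_mul h2 u) E hE
  exact integral_induce_character_pow_succ_seriesFamily (h2 := h2) (hσ₀ := hσ₀) (u := u) (hε := hε)
    (Θ := θ.comp ((CBall (v.adicCompletion K)).subtype.comp
      (algebraMap (UnrCoeff (v.adicCompletion K)) (CBall (v.adicCompletion K)))))
    (κ := (((Units.map (e₂ : v.adicCompletionIntegers K →+* ℤ_[2]).toMonoidHom).comp (rayAdicCharacter h𝔪0 hv hw))⁻¹))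
    (hU := mem_rayAdicTower_iff_inv h𝔪0 h𝔪0 hv hw e₂ le_rfl hv)
    (hκ := exists_toZModPow_padicRayAdicCharacter_inv_eq h𝔪0 h𝔪0 hv hw e₂ le_rfl hv) (ψ := ψ) (hψ := hψ)
    (φ := fun β : RelNormCoherentUnits (isUniformizer_unit_mul h2 u) E ↦
      (relTildeSeries (isUniformizer_unit_mul h2 u) E hq hE hσ₀ (LTCoeff.of (v.adicCompletion K) (u : 𝒪[v.adicCompletion K])) β).map j)
    (hC := norm_coeff_relSeries_le_one hq h2 u E hE hσ₀ hε θ hθ1 j hjC)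
    (hsock := fun β k ↦ seriesFamily_hsock_of_relNormCoherentUnits (hq := hq) (h2 := h2) (u := u) (E := E) (hE := hE)
      (hσ₀ := hσ₀) (j := j) (hε := hε) (θ := θ) (hθc := hθc) (hθ1 := hθ1) (hθζ := hθζ) (hjC := hjC) β
      (norm_coeff_relSeries_le_one hq h2 u E hE hσ₀ hε θ hθ1 j hjC β) k)
    (hC0 := zero_le_one) (hCb := fun _ ↦ le_rfl) β k

end Local

end Summit.BirchSwinnertonDyer.BirchSwinnertonDyer.Theorems.PrintCf2.EllipticUnitsGlobal

end
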